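import Mathlib
import HarnessLib.Audit
import Summits.PneNP.PneNP.Theorems.PstarGateU2BranchA
import Summits.PneNP.PneNP.Theorems.PstarGateU2BranchB
import Summits.PneNP.PneNP.Theorems.PstarGateHyperplane
import Summits.PneNP.PneNP.Theorems.PstarChordBridgeKill

/-!
# One GATED chord, node N5: COUPLED cycles are impossible (E2; prover-1 g19)

FRONTIER range-avoidance ladder, rung F-N3 (`stmt-PneNP-19007`), cell `pnp-ideate` (`PstarGateNodesX.GateU2X`); restricted-model proof complexity —
nothing here bears on `P` versus `NP`.

`N = {e, e'}`, `e` gated, `e'` doubly read.  If `u_e + u_{e'}` is CONSTANT on the gate chamber `H₁ = {x_u = κ₀ + 1}` (the (EQ) outcome of every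
forcing dichotomy on the chamber), then `Q_{D e ∆ D e'}` is constant there, so every edge of `D e ∆ D e'` passes through `u`
(`PstarGateHyperplane.const_on_hyperplane`), and:
* in branch (A) of the corner dichotomy this contradicts expansion (`PstarGateU2BranchA.u2_branchA_false`);
* in branch (B) the constant is `1` (OFF-region: `PstarGateU2Off.u2_off` at a chamber zero of `u_e`, `PstarGateU2BranchB.exists_off_on_chamber`),
  so no common tree edge exists (`PstarGateU2BranchB.u2_branchB_point` gives an ON/ON chamber point), `D e ∩ D e' = ∅`, every edge of `D e`
  passes through `u` — contradicting `PstarGateFibreRank.avoid_nonempty`.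

* `u2_coupled_false` — **`u_e + u_{e'}` constant on the gate chamber is contradictory.**
-/

set_option linter.dupNamespace false -- `Summit.PneNP.PneNP.…`: summit = sub-problem name (D-0017 single-conjunct layout)

open Finset Literature.Computability.Complexity
open scoped symmDiff
open Summit.PneNP.PneNP.Theorems.PstarTyped (Typed)
open Summit.PneNP.PneNP.Theorems.PstarSALevel (BoundaryExpanding SimpleOverlap)
open Summit.PneNP.PneNP.Theorems.PstarProductRank (qform)
open Summit.PneNP.PneNP.Theorems.PstarPathRankFibre (avoid)
open Summit.PneNP.PneNP.Theorems.PstarReadSumset (V2)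
open Summit.PneNP.PneNP.Theorems.PstarChordSystem (ChordSystem)
open Summit.PneNP.PneNP.Theorems.PstarChordBridgeTools (privs coef)
open Summit.PneNP.PneNP.Theorems.PstarChordBridge (BridgeData sys Solution Lift)
open Summit.PneNP.PneNP.Theorems.PstarChordBridgeForcing (gam sys_u_eq)
open Summit.PneNP.PneNP.Theorems.PstarChordBridgeKill (qform_symmDiff)
open Summit.PneNP.PneNP.Theorems.PstarGateBridge (GateHyp)
open Summit.PneNP.PneNP.Theorems.PstarGateHyperplane (const_on_hyperplane)
open Summit.PneNP.PneNP.Theorems.PstarGateFibreRank (avoid_nonempty)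
open Summit.PneNP.PneNP.Theorems.PstarGateNodes (GateData)
open Summit.PneNP.PneNP.Theorems.PstarGateNodesX (GateDataX)
open Summit.PneNP.PneNP.Theorems.PstarGateU2Corner (u2_corner_cases)
open Summit.PneNP.PneNP.Theorems.PstarGateU2Off (u2_off)
open Summit.PneNP.PneNP.Theorems.PstarGateU2BranchA (u2_branchA_false)
open Summit.PneNP.PneNP.Theorems.PstarGateU2BranchB (exists_off_on_chamber u2_branchB_point)

namespace Summit.PneNP.PneNP.Theorems.PstarGateU2Coupled

variable {n m : ℕ}

/-- **Coupled cycles are impossible.**  See the module docstring. -/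
theorem u2_coupled_false (I : LocalMap 4 n m) (hI : I.IsPure xorAndPred) (hT : Typed I) (hS : SimpleOverlap I) {r₀ : ℕ}
    (hB : BoundaryExpanding r₀ I) {B : BridgeData n m} {e g₀ : Fin m} {u : Fin n} {κ₀ : ZMod 2} (hD : GateDataX I r₀ B e g₀ u κ₀)
    {e' : Fin m} (hN : B.N = {e, e'}) (hne : e' ≠ e)
    (hU2 : ∀ a, (sys I B).ρ e' a ≠ 0 ∧ (sys I B).ρ' e' a ≠ 0 ∧ (sys I B).ρ e' a ≠ (sys I B).ρ' e' a)
    {c₀ : ZMod 2} (hc : ∀ x : Fin n → ZMod 2, x u = κ₀ + 1 → (sys I B).u e x + (sys I B).u e' x = c₀) : False := by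
  classical
  obtain ⟨-, hW, -, -, -, -, -, -, hG, -, -, -, -, -, -, hcoef, -, -⟩ := id hD
  have he : e ∈ B.N := hG.1
  have he' : e' ∈ B.N := by rw [hN]; exact mem_insert_of_mem (mem_singleton_self _)
  have heD : e ∉ B.D e := fun h => (mem_sdiff.1 (hW.hD e he h)).2 he
  -- `Q_{D e ∆ D e'}` is constant on the chamber, so its edges pass through `u`
  have hconst : ∀ x : Fin n → ZMod 2, x u = κ₀ + 1 →
      qform (B.D e ∆ B.D e') (fun j => I.vars j 2) (fun j => I.vars j 3) x = c₀ + gam B e + gam B e' := by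
    intro x hx
    have h := hc x hx
    rw [sys_u_eq, sys_u_eq] at h
    rw [qform_symmDiff]
    have e3 : ∀ g Q g' Q' c : ZMod 2, g + Q + (g' + Q') = c → Q + Q' = c + g + g' := by decide
    exact e3 _ _ _ _ _ h
  have hM := (const_on_hyperplane I hI hS (B.D e ∆ B.D e') u (κ₀ + 1) _ hconst).1
  rcases u2_corner_cases I hI hT hS hB hD hN hne hU2 with ⟨j₁, j₂, h12, hDe', hdisj, σ, hσ, τ, hτ, g, hg, hσg, hτg⟩ | hBr
  · exact u2_branchA_false I hI hT hS hB hD hN hne hU2 h12 hDe' hdisj hσ hτ hg hσg hτg hM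
  · -- branch (B): the constant is `1` …
    obtain ⟨x₀, hx₀u, hx₀e⟩ := exists_off_on_chamber I hI hS hW he u (κ₀ + 1)
    have hcx₀ : coef I B.C₁ B.G₁ (I.vars e 2) x₀ = 1 := by
      rw [hcoef, hx₀u]
      have e2 : ∀ k : ZMod 2, k + (k + 1) = 1 := by decide
      exact e2 κ₀
    have hc1 : c₀ = 1 := by
      have h := hc x₀ hx₀u
      rw [hx₀e, (u2_off I hI hT hD hN hne hU2 hcx₀ hx₀e).1, zero_add] at h
      exact h.symm
    -- … so no common tree edge
    have hS0 : ∀ j ∈ B.D e, j ∉ B.D e' := by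
      intro j hjD hjD'
      obtain ⟨x, hxu, hxe, hxe'⟩ := u2_branchB_point I hI hT hS hD hN hne hU2 hBr hjD hjD'
      have h := hc x hxu
      rw [hxe, hxe', hc1] at h
      exact absurd h (by decide)
    -- hence every edge of `D e` passes through `u`: no avoiding edge
    obtain ⟨j, hj⟩ := avoid_nonempty I hI hS heD (hW.hDeven e he) u
    unfold PstarPathRankFibre.avoid at hj
    obtain ⟨hjD, h2, h3⟩ := mem_filter.1 hj
    rw [mem_singleton] at h2 h3
    rcases hM j (Finset.mem_symmDiff.2 (Or.inl ⟨hjD, hS0 j hjD⟩)) with h | h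
    · exact h2 h
    · exact h3 h

end Summit.PneNP.PneNP.Theorems.PstarGateU2Coupled
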